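import Summits.ResolutionOfSingularities.ResolutionOfSingularities.Theorems.PurelyInseparableDim4SpineGame
import Summits.ResolutionOfSingularities.ResolutionOfSingularities.Theorems.PurelyInseparableDim4SpineCert
import HarnessLib
import HarnessLib.Audit.Tags

/-!
# Purely inseparable fourfolds `z^p + F(x₁,…,x₄)` — SPINE CERTIFICATES read in the desk's `SpineGame`

Census cell «res-dim4-pi» (D-0157 DOOR 2), WAVE-3 row W3-3 («Lean certifier, SPINE GAME»), file 2 of 2;
seat res-dim4-p-8.  [OURS · counted 0 · AI kernel work, weaker than expert review.]  Nothing in this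
file is a statement about resolution of singularities; nothing here proves resolution in dimension
≥ 4 / characteristic `p`.  DEF-LIGHT: two definitions (`ofC`, `CycleCert.strategy`), everything else
theorems.

§1 transports the kernel-decidable mirror of `PurelyInseparableDim4SpineCert` (positions
`Finset (Fin 4 → ℕ)`) to the desk's game `PurelyInseparableDim4SpineGame` (positions
`SpinePos = Finset (Fin 4 →₀ ℕ)`) along `Finsupp.equivFunOnFinite`: `ofC`, and the dictionary
`spinePermissible_ofC_iff` / `spineWon_ofC_iff` / `pureMove_ofC` / `spineMove_ofC`; plus the reading of
the cell's MODE-1h centre of record on supports (`isMode1hCentre_iff_support`).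
§2 turns a certificate `CycleCert q L` into a POSITIONAL STRATEGY `CycleCert.strategy` that is
CARDINALITY-FIRST everywhere (a permissible centre of least cardinality at every not-yet-won position —
the support shadow of MODE 1h, one particular tie-breaking) together with an infinite pure play
following it (`CycleCert.isPurePlay`), hence `¬ IsPurePositionalWin` (`CycleCert.not_isPurePositionalWin`);
when no cleaning deletion occurs on the cycle the same play is a play of the game WITH deletions
(`CycleCert.isSpinePlay`, `…not_isSpinePositionalWin`).
§3 the census consequence **N-CF at `q = 2` in four variables, ∃-over-ties form** (boards/ROUTES.md
WORD #23 (b)): there is a cardinality-first positional strategy of Hironaka's pure polyhedra game that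
admits an infinite play (witness: the K-A-01 cycle C-003; likewise C-006, C-002), for the pure game
AND for the spine game with deletions.  What is NOT proved (and not claimed): that EVERY
cardinality-first positional strategy loses — all certified cycles run through ties (tie lists in
file 1), and no finite cardinality-first trap is known to the cell.

Sources of the notions: [cite: Spivakovsky1983, §1 (Hironaka's polyhedra game)]
[cite: HauserPerlega2019PRIMS, §2 (the blowup in the x₁-chart)]; the cycles are OURS (census
boards/JUMPS.md §3).  bears_on: LADDER-RESOLUTION:D157-DOOR2 (res-dim4-pi · W3-3).
Supports stmt-ResolutionOfSingularities-16155 (helper).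
-/

-- cell convention (DR-157-C): the summit's doubled path segment is intended, as in the landed Target file
set_option linter.dupNamespace false

namespace Summit.ResolutionOfSingularities.ResolutionOfSingularities.Theorems.PIDim4.SpineCert

open Finset
open Literature.AlgebraicGeometry.Resolution

/-! ## 1. Transport along `Finsupp.equivFunOnFinite` -/

/-- A plain position read as a position of the desk's game (`Finsupp` exponents). [folklore] -/
noncomputable def ofC (A : Finset (Fin 4 → ℕ)) : SpinePos :=
  A.map (Finsupp.equivFunOnFinite.symm.toEmbedding)

/-- Membership in `ofC A` is membership of the coefficient function in `A`. [folklore] -/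
theorem mem_ofC {A : Finset (Fin 4 → ℕ)} {d : Fin 4 →₀ ℕ} : d ∈ ofC A ↔ ⇑d ∈ A := by
  unfold ofC
  rw [Finset.mem_map_equiv, Equiv.symm_symm]
  exact Iff.rfl

/-- `ofC` is injective. [folklore] -/
theorem ofC_injective : Function.Injective ofC := fun _ _ h => Finset.map_injective _ h

/-- `ofC A` is empty iff `A` is. [folklore] -/
theorem ofC_eq_empty {A : Finset (Fin 4 → ℕ)} : ofC A = ∅ ↔ A = ∅ := Finset.map_eq_empty

/-- The plain function `a` names the element `equivFunOnFinite.symm a` of `ofC A`. [folklore] -/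
theorem symm_mem_ofC {A : Finset (Fin 4 → ℕ)} {a : Fin 4 → ℕ} (ha : a ∈ A) :
    Finsupp.equivFunOnFinite.symm a ∈ ofC A :=
  mem_ofC.mpr (by rwa [Finsupp.coe_equivFunOnFinite_symm])

/-- Permissibility transports: `SpinePermissible q J (ofC A) ↔ permB q J A`. [folklore] -/
theorem spinePermissible_ofC_iff (q : ℕ) (J : Finset (Fin 4)) (A : Finset (Fin 4 → ℕ)) :
    SpinePermissible q J (ofC A) ↔ permB q J A = true := by
  rw [permB_eq_true_iff, SpinePermissible]
  refine and_congr Iff.rfl ⟨fun h a ha => ?_, fun h d hd => ?_⟩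
  · have := h (Finsupp.equivFunOnFinite.symm a) (symm_mem_ofC ha)
    rwa [← degInC_coe, Finsupp.coe_equivFunOnFinite_symm] at this
  · rw [← degInC_coe]
    exact h (⇑d) (mem_ofC.mp hd)

/-- The winning test transports: `SpineWon q (ofC A) ↔ wonB q A`. [folklore] -/
theorem spineWon_ofC_iff (q : ℕ) (A : Finset (Fin 4 → ℕ)) : SpineWon q (ofC A) ↔ wonB q A = true := by
  rw [wonB_eq_true_iff, SpineWon, ofC_eq_empty]
  refine or_congr Iff.rfl ⟨?_, ?_⟩
  · rintro ⟨d, hd, hlt⟩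
    exact ⟨⇑d, mem_ofC.mp hd, by rwa [degInC_univ_coe]⟩
  · rintro ⟨a, ha, hlt⟩
    refine ⟨Finsupp.equivFunOnFinite.symm a, symm_mem_ofC ha, ?_⟩
    rwa [← degInC_univ_coe, Finsupp.coe_equivFunOnFinite_symm]

/-- The pure move transports: `pureMove q J j (ofC A) = ofC (pureMoveC q J j A)`. [folklore] -/
theorem pureMove_ofC (q : ℕ) (J : Finset (Fin 4)) (j : Fin 4) (A : Finset (Fin 4 → ℕ)) :
    pureMove q J j (ofC A) = ofC (pureMoveC q J j A) := by
  ext d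
  rw [pureMove, Finset.mem_image, mem_ofC, pureMoveC, Finset.mem_image]
  constructor
  · rintro ⟨d', hd', rfl⟩
    exact ⟨⇑d', mem_ofC.mp hd', (coe_chartExponent q J j d').symm⟩
  · rintro ⟨a, ha, hda⟩
    refine ⟨Finsupp.equivFunOnFinite.symm a, symm_mem_ofC ha, ?_⟩
    apply DFunLike.coe_injective
    rw [coe_chartExponent, Finsupp.coe_equivFunOnFinite_symm]
    exact hda

/-- The spine move (with deletions) transports: `spineMove q J j (ofC A) = ofC (spineMoveC q J j A)`.
[folklore] -/
theorem spineMove_ofC (q : ℕ) (J : Finset (Fin 4)) (j : Fin 4) (A : Finset (Fin 4 → ℕ)) :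
    spineMove q J j (ofC A) = ofC (spineMoveC q J j A) := by
  ext d
  rw [spineMove, pureMove_ofC, Finset.mem_filter, mem_ofC, mem_ofC, spineMoveC, Finset.mem_filter]

/-- The cell's MODE-1h centre of record read on the support: `IsMode1hCentre q S F` iff `S` is a
permissible centre of least cardinality for the position `F.support`. [folklore] -/
theorem isMode1hCentre_iff_support {K : Type} [Field K] (q : ℕ) (S : Finset (Fin 4))
    (F : MvPolynomial (Fin 4) K) :
    IsMode1hCentre q S F ↔
      (SpinePermissible q S F.support ∧
        ∀ S' : Finset (Fin 4), SpinePermissible q S' F.support → S.card ≤ S'.card) := by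
  simp only [IsMode1hCentre, spinePermissible_support_iff]

/-- A not-yet-won position admits the point (all four variables) as a permissible centre. [folklore] -/
theorem spinePermissible_univ_of_not_spineWon {q : ℕ} {A : SpinePos} (h : ¬ SpineWon q A) :
    SpinePermissible q Finset.univ A := by
  refine ⟨Finset.univ_nonempty, fun a ha => ?_⟩
  rw [CentreBlowup.degIn_univ]
  by_contra hlt
  exact h (Or.inr ⟨a, ha, Nat.lt_of_not_le hlt⟩)

/-- If some centre is permissible, some permissible centre has least cardinality. [folklore] -/
theorem exists_cardFirst_of_exists {q : ℕ} {A : SpinePos} (h : ∃ J, SpinePermissible q J A) :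
    ∃ J, SpinePermissible q J A ∧ ∀ J', SpinePermissible q J' A → J.card ≤ J'.card := by
  classical
  have hex : ∃ n, ∃ J, SpinePermissible q J A ∧ J.card = n :=
    let ⟨J, hJ⟩ := h; ⟨J.card, J, hJ, rfl⟩
  obtain ⟨J, hJ, hcard⟩ := Nat.find_spec hex
  refine ⟨J, hJ, fun J' hJ' => ?_⟩
  rw [hcard]
  exact Nat.find_min' hex ⟨J', hJ', rfl⟩

/-! ## 2. From a certificate to a cardinality-first positional strategy with an infinite play -/

namespace CycleCert

variable {q : ℕ} {L : List (Finset (Fin 4 → ℕ) × Finset (Fin 4) × Fin 4)}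

open Classical in
/-- **The strategy read off a certificate**: at a cycle position the certified centre; at any other
position a permissible centre of least cardinality if one exists (else `∅`).  Positional by
construction. [folklore] -/
noncomputable def strategy (_h : CycleCert q L) : SpineStrategy := fun X =>
  if hX : ∃ k : Fin L.length, ofC (L.get k).1 = X then (L.get hX.choose).2.1
  else if hP : ∃ J, SpinePermissible q J X then (exists_cardFirst_of_exists hP).choose
  else ∅

/-- At the `n`-th position of the periodic play the strategy returns the certified centre. [folklore] -/
theorem strategy_play (h : CycleCert q L) (n : ℕ) : h.strategy (ofC (h.play n)) = h.centre n := by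
  have hX : ∃ k : Fin L.length, ofC (L.get k).1 = ofC (h.play n) := ⟨h.idx n, rfl⟩
  unfold strategy
  rw [dif_pos hX]
  have hk : hX.choose = h.idx n :=
    h.get_eq_of_fst_eq (ofC_injective hX.choose_spec)
  rw [hk]
  rfl

/-- **The strategy is cardinality-first**: at every not-yet-won position it picks a permissible centre
of least cardinality (the support shadow of the cell's MODE 1h, with one particular tie-breaking).
[folklore] -/
theorem strategy_cardFirst (h : CycleCert q L) (X : SpinePos) (hX : ¬ SpineWon q X) :
    SpinePermissible q (h.strategy X) X ∧
      ∀ J, SpinePermissible q J X → (h.strategy X).card ≤ J.card := by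
  unfold strategy
  by_cases hc : ∃ k : Fin L.length, ofC (L.get k).1 = X
  · rw [dif_pos hc]
    set k := hc.choose with hkdef
    have hk : ofC (L.get k).1 = X := hc.choose_spec
    have hcf := h.2.2 k
    rw [stepB_eq_true_iff] at hcf
    obtain ⟨-, hcard, -, -⟩ := hcf
    obtain ⟨hperm, hmin⟩ := (cardFirstB_eq_true_iff _ _ _).mp hcard
    rw [← hk]
    exact ⟨(spinePermissible_ofC_iff q _ _).mpr hperm,
      fun J hJ => hmin J ((spinePermissible_ofC_iff q J _).mp hJ)⟩
  · rw [dif_neg hc]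
    have hP : ∃ J, SpinePermissible q J X := ⟨Finset.univ, spinePermissible_univ_of_not_spineWon hX⟩
    rw [dif_pos hP]
    exact (exists_cardFirst_of_exists hP).choose_spec

/-- **The periodic play follows the strategy**: an infinite PURE play. [folklore] -/
theorem isPurePlay (h : CycleCert q L) : IsPurePlay q h.strategy fun n => ofC (h.play n) := by
  intro n
  refine ⟨?_, h.chart n, ?_, ?_⟩
  · rw [spineWon_ofC_iff, h.not_won n]
    exact Bool.false_ne_true
  · rw [strategy_play]
    exact h.chart_mem n
  · show ofC (h.play (n + 1)) = pureMove q (h.strategy (ofC (h.play n))) (h.chart n) (ofC (h.play n))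
    rw [strategy_play, pureMove_ofC, h.play_succ n]

/-- Hence the strategy is NOT a positional win of the pure game. [folklore] -/
theorem not_isPurePositionalWin (h : CycleCert q L) : ¬ IsPurePositionalWin q h.strategy :=
  fun hw => hw.2 ⟨fun n => ofC (h.play n), h.isPurePlay⟩

/-- If no cleaning deletion happens on the certified edges, the periodic play is also a play of the
spine game WITH deletions. [folklore] -/
theorem isSpinePlay (h : CycleCert q L)
    (hdel : ∀ k : Fin L.length,
      spineMoveC q (L.get k).2.1 (L.get k).2.2 (L.get k).1 = pureMoveC q (L.get k).2.1 (L.get k).2.2 (L.get k).1) :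
    IsSpinePlay q h.strategy fun n => ofC (h.play n) := by
  intro n
  refine ⟨?_, h.chart n, ?_, ?_⟩
  · rw [spineWon_ofC_iff, h.not_won n]
    exact Bool.false_ne_true
  · rw [strategy_play]
    exact h.chart_mem n
  · show ofC (h.play (n + 1)) = spineMove q (h.strategy (ofC (h.play n))) (h.chart n) (ofC (h.play n))
    rw [strategy_play, spineMove_ofC, h.play_succ n]
    exact congrArg ofC (hdel (h.idx n)).symm

/-- … and then the strategy is NOT a positional win of the spine game with deletions either. [folklore] -/
theorem not_isSpinePositionalWin (h : CycleCert q L)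
    (hdel : ∀ k : Fin L.length,
      spineMoveC q (L.get k).2.1 (L.get k).2.2 (L.get k).1 = pureMoveC q (L.get k).2.1 (L.get k).2.2 (L.get k).1) :
    ¬ IsSpinePositionalWin q h.strategy :=
  fun hw => hw.2 ⟨fun n => ofC (h.play n), h.isSpinePlay hdel⟩

end CycleCert

/-! ## 3. N-CF at `q = 2` in four variables (∃-over-ties form) -/

/-- No deletion occurs on the two certified edges of C-003 (indexed form for `CycleCert.isSpinePlay`).
[OURS · ‖ K] [folklore] -/
theorem c003_noDeletion (k : Fin c003.length) :
    spineMoveC 2 (c003.get k).2.1 (c003.get k).2.2 (c003.get k).1 =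
      pureMoveC 2 (c003.get k).2.1 (c003.get k).2.2 (c003.get k).1 := by
  revert k
  unfold c003 c003A₀ c003A₁
  decide

/-- **N-CF, pure game (OURS; WORD #23 (b), ∃-over-ties form).**  In Hironaka's pure polyhedra game
in four variables at `q = 2` there is a CARDINALITY-FIRST positional strategy of player A — at every
not-yet-won position it blows up a permissible centre of least cardinality, i.e. of largest dimension
(the support shadow of the cell's MODE 1h of record, with one particular tie-breaking) — which admits
an infinite play (the K-A-01 2-cycle C-003 read on supports) and is therefore not a positional win.
Not claimed: that every tie-breaking of cardinality-first loses. [OURS · ‖ K] [folklore] -/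
theorem exists_cardFirst_strategy_not_purePositionalWin_two :
    ∃ σ : SpineStrategy,
      (∀ A : SpinePos, ¬ SpineWon 2 A →
          SpinePermissible 2 (σ A) A ∧ ∀ J, SpinePermissible 2 J A → (σ A).card ≤ J.card) ∧
        (∃ A : ℕ → SpinePos, IsPurePlay 2 σ A) ∧ ¬ IsPurePositionalWin 2 σ :=
  ⟨cycleCert_c003.strategy, cycleCert_c003.strategy_cardFirst,
    ⟨_, cycleCert_c003.isPurePlay⟩, cycleCert_c003.not_isPurePositionalWin⟩

/-- **N-CF, spine game with deletions (OURS).**  The same cardinality-first positional strategy admits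
an infinite play of the spine game WITH the cleaning deletions (none occurs on C-003), so it is not a
positional win of `PositionalWin4`'s game either. [OURS · ‖ K] [folklore] -/
theorem exists_cardFirst_strategy_not_spinePositionalWin_two :
    ∃ σ : SpineStrategy,
      (∀ A : SpinePos, ¬ SpineWon 2 A →
          SpinePermissible 2 (σ A) A ∧ ∀ J, SpinePermissible 2 J A → (σ A).card ≤ J.card) ∧
        (∃ A : ℕ → SpinePos, IsSpinePlay 2 σ A) ∧ ¬ IsSpinePositionalWin 2 σ :=
  ⟨cycleCert_c003.strategy, cycleCert_c003.strategy_cardFirst,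
    ⟨_, cycleCert_c003.isSpinePlay c003_noDeletion⟩,
    cycleCert_c003.not_isSpinePositionalWin c003_noDeletion⟩

/-- The C-006 variant (centres = coordinate 3-planes): its cardinality-first strategy also admits an
infinite pure play. [OURS · ‖ K] [folklore] -/
theorem isPurePlay_c006 : IsPurePlay 2 cycleCert_c006.strategy fun n => ofC (cycleCert_c006.play n) :=
  cycleCert_c006.isPurePlay

/-- The C-002 variant (period 3, centres = lines): its cardinality-first strategy also admits an
infinite pure play. [OURS · ‖ K] [folklore] -/
theorem isPurePlay_c002 : IsPurePlay 2 cycleCert_c002.strategy fun n => ofC (cycleCert_c002.play n) :=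
  cycleCert_c002.isPurePlay

end Summit.ResolutionOfSingularities.ResolutionOfSingularities.Theorems.PIDim4.SpineCert
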